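import Summits.BirchSwinnertonDyer.BirchSwinnertonDyer.Theorems.ErratumRoadFiveNonSurjCornerBranchesDefs
import Summits.BirchSwinnertonDyer.Rank1Residual.X11b.Three.KolyvaginLine
import Summits.BirchSwinnertonDyer.Rank1Residual.X11b.RingClassFieldNoTorsionOfIrreducible
import Summits.BirchSwinnertonDyer.Rank1Residual.X11b.SplitPrimeUnramified
import Literature.NumberTheory.EllipticCurves.HeegnerPointsOfConductorOneData
import Literature.NumberTheory.EllipticCurves.BSDSelmerPConverseYanZhuKolyvaginSystemProofs
import Literature.NumberTheory.EllipticCurves.WeilPairingProofs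
import HarnessLib

/-!
# Route `ErratumRoadFive` (rung K2, `p ≥ 5`), crux child `NonSurjCornerKolyZ` (item stmt-BirchSwinnertonDyer-19946,
# parent 19065 `NonSurjCorner`): the certificate branch Zₚᶜ ON THE UNIT-INDEX LOCUS — a level-1, depth-0 certificate
# `CertificateAt Dt β ι p 0` at every corner frame whose bottom Heegner point `y_K` is NOT `p`-divisible in `E(K)`
# (cell `bsd-stepL`, seat `bsd-stepL-corner-p1` g7; `--supports stmt-BirchSwinnertonDyer-19946`)

WHAT. The child `NonSurjCornerKolyZ` asks, at every (T4′) corner frame `(E, p, K, Dt, β, ι)`, for SOME level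
`M ≤ t = ord_p ∏ c_ℓ(E/ℚ)` carrying a refined-Kolyvagin certificate `CertificateAt Dt β ι p M` (a Kolyvagin–Heegner
datum of square-free conductor `n ∈ S_r(M+1)` with `P_n ∉ p^{M+1} E(K[n])`). This file proves the branch on the
UNIT-INDEX locus — the frames at which the conductor-`1` derived point `P_1 = y_K`, read in `E(K)` by Galois descent,
is not `p`-divisible in `E(K)` (`ord_p [E(K) : ℤ y_K] = 0`; by Gross–Zagier + BSD this is the `t = 0 ∧ Ш(E/K)[p] = 0`
locus; 24 of the 64 corner class-pairs at `p = 5`, `N < 5·10⁵`, have `t = 0`, HOME/corner/g3/corner57.tsv) — with the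
certificate at `n = 1`, `M = 0`: `y_K ∉ p E(K) ⟹ P_1 ∉ p E(K[1])` because `E(K[1])` has no `p`-torsion. The
no-torsion input is Gross 1991 Lemma 4.3 WITHOUT surjectivity: x11b3-p4's
`torsionBy_pow_ringClassField_eq_bot_of_hasIrreducibleModPGaloisRep` (irreducible `E[p]`, `p` odd, Weil pairing —
a tree THEOREM `exists_weilPairing_holds` —, `p` unramified in `K` — from the Heegner hypothesis since `p ∣ N`,
`isUnramifiedIn_of_satisfiesHeegnerHypothesis_of_dvd`); the descent `p ∣ P_1 in E(K[1]) ⟺ p ∣ y_K in E(K)` is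
x11b3's `Koly.pDiv_one_iff_exists_zsmul_eq` (McCallum Lemma 5.1, first display). The datum `d₁` exists by Darmon
2004 Thm. 3.6 (`phi_heegnerTau_mem_singularModuliField`, named fact `hD36`) and its bottom point descends to a
Heegner point `y_K ∈ E(K)` by Shimura reciprocity at conductor `1` (`heegnerPointOfConductor_one_galoisConj`, named
fact `hrec`) — conjuncts 11 and 10 of the corner's support bundle `KatoTwinFactsFiveAn`.

* §1 `Koly.certificateAt_zero_of_not_pDiv_one` — `P_1 ∉ p E(K[1])` IS a level-1 certificate at depth 0
  (`1 ∈ S_0(1)` vacuously).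
* §2 `Koly.not_pDiv_one_of_not_exists_smul_eq` — on the irreducible cell (`p` odd, `E[p]` irreducible, `K`
  imaginary quadratic Heegner for `N` with `p ∣ N`): if `y_K ∈ E(K)` maps to `P_1` and `y_K ∉ p E(K)` then
  `P_1 ∉ p E(K[1])`.
* §3 **`Theorems.nonSurjCornerKolyZ_of_bottom_not_divisible`** — the child's conclusion
  `∃ M ≤ ord_p ∏c, CertificateAt Dt β ι p M` at every corner frame carrying the extra hypothesis
  «every conductor-1 datum's bottom point, read in `E(K)`, is not `p`-divisible», modulo `hD36` and `hrec`.
  This is the child's BC5 RUNG in the kernel (the planner's card had it «plan-only»): Zₚᶜ restricted to the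
  unit-index locus follows from two named print facts + a per-pair statement in `E(K)`-currency (a Heegner-point
  height ∕ saturation computation).

HONEST FRAMING: three theorems (no definition, no named fact minted, no `sorry`); CONDITIONAL on `hD36`, `hrec` and
the displayed per-frame hypothesis; nothing is asserted about any curve; the OPEN content of 19946 is the
complementary locus (`y_K ∈ p E(K)`: `t ≥ 1` or `Ш(E/K)[p] ≠ 0` — Kolyvagin's conjecture proper at a non-surjective
image and `p ∥ N`); item 19946 does NOT close; BSD is not advanced; no census word moves (T7).

References: [McCallumLMS1991] §5 Lemma 5.1 (p. 303) and its proof (p. 304), Cor. 5.6 (p. 310); [GrossLMS1991] §1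
(p. 236: `y_K = Tr y_1`), §4 Lemma 4.3 and (4.1); [Darmon2004] Thm. 3.6; [Cox2013] §9.A; [WZhang2014] Rem. 5 (p. 199,
`M_∞ = 0`); tree: `X11b/Three/KolyvaginLine.lean` (x11b3-p1), `X11b/RingClassFieldNoTorsionOfIrreducible.lean`
(x11b3-p4), `X11b/SplitPrimeUnramified.lean`, `Theorems/ErratumRoadFiveNonSurjCornerBranchesDefs.lean` (p486726).
-/

set_option autoImplicit false
set_option linter.dupNamespace false

noncomputable section

open scoped Classical NumberField

namespace Summit.BirchSwinnertonDyer.Rank1Residual.X11b.Three.Koly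

open WeierstrassCurve NumberField IsDedekindDomain
  Literature.NumberTheory.EllipticCurves Literature.NumberTheory.EllipticCurves.ModularForms
  Literature.NumberTheory.EllipticCurves.Rank1Residual
  Summit.BirchSwinnertonDyer.Rank1Residual Summit.BirchSwinnertonDyer.Rank1Residual.X11b

variable {N : ℕ} [NeZero N] {W : WeierstrassCurve ℚ} {K : Type} [Field K] [NumberField K]
  {Dt : ModularParametrizationData W N} {β : ℤ} {ι : K →+* ℂ}

/-! ### §1 `P_1 ∉ p E(K[1])` is a level-1 certificate at depth 0 -/

/-- **A conductor-`1` datum with `P_1 ∉ p E(K[1])` is a certificate `CertificateAt Dt β ι p 0`**: `n = 1` is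
square-free with no prime factor, so `1 ∈ S_0(1)` vacuously (`MemS N W K p 0 1 1`), and `¬ PDiv d₁ p 1` is the
non-divisibility clause — McCallum's `M_0 ≤ 0`, i.e. `M_∞ = 0` read at level `1`.
[cite: McCallumLMS1991, §5 (p. 303), definitions of S_r(M), M_r; Lemma 5.1] -/
theorem certificateAt_zero_of_not_pDiv_one [W.IsGloballyMinimal] (d₁ : KolyvaginHeegnerData Dt β ι 1) {p : ℕ}
    (h : ¬ PDiv d₁ p 1) : CertificateAt Dt β ι p 0 :=
  ⟨1, 0, d₁, ⟨squarefree_one, by simp, by simp⟩, h⟩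

/-! ### §2 Descent of `p`-divisibility from `E(K[1])` to `E(K)` on the irreducible cell -/

/-- **`y_K ∉ p E(K) ⟹ P_1 ∉ p E(K[1])`, WITHOUT surjectivity.** For `E/ℚ` with `E[p]` irreducible, `p` odd, `K`
imaginary quadratic in which `p` splits (`SatisfiesHeegnerHypothesis p K`, so `p` is unramified in `K`), a
conductor-`1` datum `d₁` and `y ∈ E(K)` mapping to `P_1 = d₁.derivedPoint`: `E(K[1])` has no `p`-torsion
(Gross 1991 Lemma 4.3 on the irreducible cell: `torsionBy_pow_ringClassField_eq_bot_of_hasIrreducibleModPGaloisRep`,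
with the Weil pairing supplied by the tree theorem `exists_weilPairing_holds`), so `p ∣ P_1` in `E(K[1])` iff
`p ∣ y` in `E(K)` (`pDiv_one_iff_exists_zsmul_eq`, McCallum Lemma 5.1). CONDITIONAL on nothing beyond the displayed
hypotheses. [cite: McCallumLMS1991, §5 Lemma 5.1 (p. 303) and its proof (p. 304)]
[cite: GrossLMS1991, §4 Lemma 4.3] [cite: Cox2013, §9.A (K[m]/K unramified outside m)] -/
theorem not_pDiv_one_of_not_exists_smul_eq [W.IsElliptic] (hK : IsImaginaryQuadratic K)
    {p : ℕ} (hp : p.Prime) (hp2 : p ≠ 2) (hirr : W.HasIrreducibleModPGaloisRep p)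
    (hHp : SatisfiesHeegnerHypothesis p K)
    (d₁ : KolyvaginHeegnerData Dt β ι 1) (y : (W.baseChange K).toAffine.Point)
    (hy : WeierstrassCurve.Affine.Point.map (W' := W) (algebraMap K (ringClassField K ι 1)).toRatAlgHom y =
      d₁.derivedPoint)
    (hndiv : ¬ ∃ Q : (W.baseChange K).toAffine.Point, (p : ℤ) • Q = y) : ¬ PDiv d₁ p 1 := by
  -- `E(K[1])[p] = 0` on the irreducible cell
  have hp1 : ¬ p ∣ 1 := fun h => hp.one_lt.ne' (Nat.dvd_one.mp h)
  have hbot := NoTorsionIrr.torsionBy_pow_ringClassField_eq_bot_of_hasIrreducibleModPGaloisRep W hK ι one_ne_zero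
    hp hp2 hirr (WeierstrassCurve.exists_weilPairing_holds W p)
    (isUnramifiedIn_of_satisfiesHeegnerHypothesis_of_dvd hK hHp hp dvd_rfl) hp1 1
  have htor : ∀ R : (W.baseChange (ringClassField K ι 1)).toAffine.Point, ((p ^ 1 : ℕ) : ℤ) • R = 0 → R = 0 := by
    intro R hR
    have hmem : R ∈ AddSubgroup.torsionBy (W.baseChange (ringClassField K ι 1)).toAffine.Point ((p ^ 1 : ℕ) : ℤ) :=
      (Submodule.mem_torsionBy_iff _ R).mpr hR
    rw [hbot] at hmem
    exact hmem
  intro hdiv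
  obtain ⟨Q, hQ⟩ := (pDiv_one_iff_exists_zsmul_eq hK d₁ y hy p 1 htor).mp hdiv
  exact hndiv ⟨Q, by simpa using hQ⟩

end Summit.BirchSwinnertonDyer.Rank1Residual.X11b.Three.Koly

namespace Summit.BirchSwinnertonDyer.BirchSwinnertonDyer.Theorems

open WeierstrassCurve NumberField IsDedekindDomain Field
  Literature.NumberTheory.EllipticCurves Literature.NumberTheory.EllipticCurves.ModularForms
  Literature.NumberTheory.EllipticCurves.Rank1Residual
  Summit.BirchSwinnertonDyer.Rank1Residual Summit.BirchSwinnertonDyer.Rank1Residual.X11b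
  Summit.BirchSwinnertonDyer.Rank1Residual.X11b.Three.Koly

/-! ### §3 Zₚᶜ on the unit-index locus -/

/-- **The certificate branch `NonSurjCornerKolyZ` (item 19946) ON THE UNIT-INDEX LOCUS.** For every (T4′) corner
frame — `W/ℚ` globally minimal with `(E,p) ∈` X11b, `ρ̄_{E,p}` not onto, `p ∈ {5,7}`, `p ∣ ord_p Δ_min`, no (ram)
witness, `N = N_E`, `K` imaginary quadratic with `|d_K| > 4`, Heegner for `N` and for `p`, `β² ≡ d_K (mod 4N)`,
`p ∤ Dt.c` — carrying the extra hypothesis «for every conductor-1 Kolyvagin–Heegner datum `d₁` on `(Dt, β, ι)` and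
every `y ∈ E(K)` mapping to `P_1`, `y ∉ p E(K)`» (the frame's Heegner point `y_K` has `p`-UNIT index), there is a
certificate at depth `M = 0 ≤ ord_p ∏c`: the datum `d₁` exists (Darmon 2004 Thm. 3.6, `hD36`), its bottom point
descends to a Heegner point of `E(K)` (Shimura reciprocity at conductor 1, `hrec`), the hypothesis makes it
non-`p`-divisible in `E(K)`, §2 lifts that to `P_1 ∉ p E(K[1])`, §1 packages it. Most frame binders are unused
(the argument needs only (irr), `p` odd, the Heegner hypothesis and `β`); they are displayed so that the statement
is the child's text plus ONE hypothesis. CONDITIONAL on `hD36`, `hrec` and that hypothesis; nothing booked; 19946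
stays OPEN on the complementary locus. [cite: McCallumLMS1991, §5 Lemma 5.1 (p. 303), Cor. 5.6 (p. 310)]
[cite: GrossLMS1991, §4 Lemma 4.3 and (4.1)] [cite: Darmon2004, Thm. 3.6] [cite: WZhang2014, Rem. 5 (p. 199)] -/
theorem nonSurjCornerKolyZ_of_bottom_not_divisible
    (hD36 : ∀ (N : ℕ) [NeZero N] (W : WeierstrassCurve ℚ) (K : Type) [Field K] [NumberField K],
      phi_heegnerTau_mem_singularModuliField N W K)
    (hrec : ∀ (N : ℕ) [NeZero N] (W : WeierstrassCurve ℚ) (K : Type) [Field K] [NumberField K],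
      heegnerPointOfConductor_one_galoisConj N W K) :
    ∀ (W : WeierstrassCurve ℚ) [W.IsElliptic] [W.IsGloballyMinimal] (p : ℕ) [Fact p.Prime]
      (N : ℕ) [NeZero N] (K : Type) [Field K] [NumberField K]
      (Dt : ModularParametrizationData W N) (β : ℤ) (ι : K →+* ℂ),
      ClassX11b W p → ¬ Surj W p → (p = 5 ∨ p = 7) → p ∣ padicValInt p W.minimalDiscriminantInt →
      ¬ Ram W p → W.conductorNorm ℤ = N → IsImaginaryQuadratic K →
      4 < (NumberField.discr K).natAbs → SatisfiesHeegnerHypothesis N K →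
      SatisfiesHeegnerHypothesis p K → (4 * (N : ℤ)) ∣ β ^ 2 - NumberField.discr K → ¬ (p : ℤ) ∣ Dt.c →
      (∀ (d₁ : KolyvaginHeegnerData Dt β ι 1) (y : (W.baseChange K).toAffine.Point),
        WeierstrassCurve.Affine.Point.map (W' := W) (algebraMap K (ringClassField K ι 1)).toRatAlgHom y =
          d₁.derivedPoint → ¬ ∃ Q : (W.baseChange K).toAffine.Point, (p : ℤ) • Q = y) →
      ∃ M : ℕ, M ≤ padicValNat p W.tamagawaProduct ∧ CertificateAt Dt β ι p M := by
  intro W _ _ p _ N _ K _ _ Dt β ι hX _ _ _ _ _ hK _ hHN hHp hβ _ hunit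
  obtain ⟨_, hp2, _, hirr⟩ := id hX
  have hp : p.Prime := Fact.out
  -- the conductor-1 datum (Darmon 2004 Thm. 3.6) and its bottom point in `E(K)` (Shimura reciprocity)
  obtain ⟨d₁⟩ := exists_kolyvaginHeegnerData_one (hD36 N W K) hK Dt β ι hβ
  obtain ⟨y, -, hy⟩ := heegnerSystem_exists_isHeegnerPoint_map_eq_derivedPoint_one (hrec N W K) hK hHN d₁
  exact ⟨0, Nat.zero_le _, certificateAt_zero_of_not_pDiv_one d₁
    (not_pDiv_one_of_not_exists_smul_eq hK hp hp2 hirr hHp d₁ y hy (hunit d₁ y hy))⟩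

end Summit.BirchSwinnertonDyer.BirchSwinnertonDyer.Theorems

end
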